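import Summits.CriticalPhenomena.PercolationContinuityZ3.Theorems.PercNearOneGluingNoHeavyQuantLowCrossHeavyLongCells
import Summits.CriticalPhenomena.PercolationContinuityZ3.Theorems.PercNearOneGluingNoHeavyQuantTwoLowFlowTop
import HarnessLib

/-!
# QUANT lane R8, T-DEC, binder (II) `ConvClosedTResidue`: the LOW-CROSS PIECE WITH THE LONG CELL HEAVY is DEC at the credit target
# (part 3: a two-low flow lemma with a giant top, and the `DECAtT` statement — binder (i) of lead g26's V291 addendum)

builds on p205010 (kernel theorem, internal audit signed; external expert review pending)

Support file (`--supports stmt-CriticalPhenomena-4575`), QUANT lane seat prim-quant-arm-2 (gen 31), rung R8 of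
`run/shared/lean/prim/quant/LADDER.md`.  Theorems only, standard axioms, no sorries, no definitions.
* **`LawDec.twoBlob_lowCross_heavyLong_decAtT`** — light short cell `(A, γ)`, heavy long cell `(B, g)`, `B ≤ j < A + B`, `2A < c ≤ 2B`:
  `DECAtT x c j (A + B) LAW2[A, γ; B, g]` at the credit target `c = A(γ−x²)/(1−x) + Bg`, EVERY aspect ratio (cells `tfpCell_LC_*` of part 2).
* `LawDec.twoBlobShift_lowCross_heavyLong_decAtT`, `lowCrossHeavyLongPiece_decAtT`, `shift_lowCrossHeavyLongPairs_decAtT`,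
  `lconv_lowCrossHeavyLongPairs_decAtT` — the same piece shifted, in cell coordinates, in the `SH`-mixture form of `lconv_TP`, and as `LawDec.lconv`.
EXACT FINDINGS (seat folder `work/tfp/piece3.py`, `lc.py`): long cell heavy — 0 failures / 108 000 exact corner runs (spans ≤ 48, every floor and
gate); long cell LIGHT — the shape fails already at aspect 4 (e.g. `x = 1/2`, short cell sure of span 2, long cell `g = 2/5` of span 8, slack `−1/5`;
gates ≤ 0.9: 212 / 490), so those pieces stay in the pool class of the (II) route.

[this work]; DEC rules ARCH-TREES-G49 §2.2 / DEC-TAMP-G50 §3.1, the single-low criterion `…QuantSingleLowCapacity` (typer g23), the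
cell-certificate pipeline FOR-PROVERS-CERT-PIPELINE (typer g23), the (II) piece anatomy FOR-PROVERS-CONV-PIECES (lead g26) — this lane.
Nothing here is cited as a published result.  The gluing rows served [cite: KozmaNitzan2024, Conjecture 3 (p. 15)]; product measure
[cite: Grimmett1999, §1.3 p. 10].
-/

noncomputable section

namespace Summit.CriticalPhenomena.PercolationContinuityZ3.Theorems

namespace Quant

open Finset

/-- the two-point law `{lo, hi; g}` (as in `…QuantLawDEC`) -/
local notation3 "TP[" lo ", " hi ", " g ", " h "]" =>
  (g : ℝ) * (if (h : ℕ) = (hi : ℕ) then (1 : ℝ) else 0) + (1 - (g : ℝ)) * (if (h : ℕ) = (lo : ℕ) then (1 : ℝ) else 0)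

/-- the law `μ` shifted up by `s` (as in `…QuantConvHeavy`) -/
local notation3 "SH[" μ ", " s ", " h "]" => (if (s : ℕ) ≤ (h : ℕ) then (μ : ℕ → ℝ) ((h : ℕ) - (s : ℕ)) else (0 : ℝ))

/-- the two-blob law `(1−u)(1−v)δ₀ + u(1−v)δ_a + (1−u)vδ_b + uvδ_{a+b}` evaluated at `h` (as in `…QuantBlobDecTwoLawParts`) -/
local notation3 "LAW2[" a ", " u ", " b ", " v ", " h "]" =>
  (1 - (u : ℝ)) * (1 - (v : ℝ)) * (if (h : ℕ) = 0 then (1 : ℝ) else 0)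
    + (u : ℝ) * (1 - (v : ℝ)) * (if (h : ℕ) = (a : ℕ) then (1 : ℝ) else 0)
    + (1 - (u : ℝ)) * (v : ℝ) * (if (h : ℕ) = (b : ℕ) then (1 : ℝ) else 0)
    + (u : ℝ) * (v : ℝ) * (if (h : ℕ) = (a : ℕ) + (b : ℕ) then (1 : ℝ) else 0)

namespace LawDec

/-! ### Assembly: the low-cross piece with the long cell heavy -/

set_option maxHeartbeats 1600000 in
/-- **THE LOW-CROSS PIECE WITH THE LONG CELL HEAVY IS DEC** (binder (i) of lead g26's V291 addendum, `twoBlob_lowCross_heavyLong_decAtT`).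
Floor `0 < x < 1`; a LIGHT cell of span `A` (gate `x² < γ < x`, credit rate `κ = (γ − x²)/(1 − x)`) and a HEAVY cell of LONGER span
`B > A` (gate `x ≤ g ≤ 1`); the piece `LAW2[A, γ; B, g]` (atoms `0, A, B, A+B`) at the credit target `c = A·κ + B·g`, at a layer `j` with
`B ≤ j < A + B` (the top a giant, `B` a mid: `c ≤ 2B`) in the shape where the short cell's head atom `A` is LOW (`2A < c`) — the `LMLG`/`LLMG`
shape of the (II) certificate — is `DECAtT x c j (A + B)`, at EVERY aspect ratio.  Proof: the corner flow (atom `A` fills the mid `B` first,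
then atom `0`, leftovers to the giant) via `twoBlob_decAtT_of_twoLowFlow_top`, its giant inequality cell by cell (`tfpCell_LC_*`).
EXACT FINDING (seat folder `work/tfp/piece3.py`, `lc.py`): 0 failures / 108 000 (spans ≤ 48, all floors and gates); with the long cell LIGHT
the same shape FAILS (e.g. `x = 1/2`, short cell sure of span 2, long cell `g = 2/5` of span 8: slack `−1/5`), so those pieces stay pooled. [this work] -/
theorem twoBlob_lowCross_heavyLong_decAtT (x γ g : ℝ) (A B j : ℕ) (hx0 : 0 < x) (hx1 : x < 1)
    (hγ0 : x ^ 2 < γ) (hγx : γ < x) (hxg : x ≤ g) (hg1 : g ≤ 1) (hA : 1 ≤ A) (hAB : A < B) (hBj : B ≤ j) (hj : j + 1 ≤ A + B)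
    (hlow : 2 * (A : ℝ) < (A : ℝ) * ((γ - x ^ 2) / (1 - x)) + (B : ℝ) * g)
    (hcB : (A : ℝ) * ((γ - x ^ 2) / (1 - x)) + (B : ℝ) * g ≤ 2 * (B : ℝ)) :
    DECAtT x ((A : ℝ) * ((γ - x ^ 2) / (1 - x)) + (B : ℝ) * g) j (A + B) (fun h => LAW2[A, γ, B, g, h]) := by
  classical
  have h1x : 0 < 1 - x := by linarith
  set k : ℝ := (γ - x ^ 2) / (1 - x) with hk
  have hk0 : 0 < k := div_pos (by linarith) h1x
  have hkx : k < x := by rw [hk, div_lt_iff₀ h1x]; nlinarith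
  have hγk : γ = x ^ 2 + (1 - x) * k := by rw [hk]; field_simp; ring
  set c : ℝ := (A : ℝ) * k + (B : ℝ) * g with hc
  have hA0 : (0 : ℝ) < A := by exact_mod_cast hA
  have hAB' : (A : ℝ) < B := by exact_mod_cast hAB
  have hB0 : (0 : ℝ) < B := by linarith
  have hg0 : 0 < g := lt_of_lt_of_le hx0 hxg
  set w : ℝ := (A : ℝ) / B with hw
  have hw0 : 0 < w := div_pos hA0 hB0
  have hw1 : w < 1 := by rw [hw, div_lt_one hB0]; exact hAB'
  have hAw : (A : ℝ) = w * B := by rw [hw]; field_simp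
  have hcw : c = (B : ℝ) * (w * k + g) := by rw [hc, hAw]; ring
  have hloww : 2 * w < w * k + g := by
    have h2 : 2 * (w * B) < B * (w * k + g) := by rw [← hAw, ← hcw]; exact hlow
    nlinarith
  have hcAB : c < (A : ℝ) + B := by
    rw [hc]; nlinarith [mul_lt_mul_of_pos_left (lt_trans hkx hx1) hA0, mul_le_mul_of_nonneg_left hg1 hB0.le]
  have hγ0' : 0 ≤ γ := by nlinarith
  have hγ1 : γ ≤ 1 := by linarith
  -- masses
  have hm0 : 0 ≤ (1 - γ) * (1 - g) := mul_nonneg (by linarith) (by linarith)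
  have hmA : 0 ≤ γ * (1 - g) := mul_nonneg hγ0' (by linarith)
  have hmB : 0 ≤ (1 - γ) * g := mul_nonneg (by linarith) hg0.le
  have hmAB : 0 ≤ γ * g := mul_nonneg hγ0' hg0.le
  -- closed forms of the two usages in the `w`-coordinates
  have hN0pos : 0 < w * k + g := by nlinarith [mul_pos hw0 hk0]
  have hDHpos : 0 < w + 1 - w * k - g := by nlinarith [mul_pos hw0 (sub_pos.2 (lt_trans hkx hx1))]
  have hNHpos : 0 < w * k + g - 2 * w := by linarith
  have hNLpos : 0 < x ^ 2 * (1 - w) + (1 - x) * (w * k + g - 2 * w) := by nlinarith [mul_pos (pow_pos hx0 2) (sub_pos.2 hw1)]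
  have hDLin : 0 < (1 - x) * w + (1 + x) - (w * k + g) := by nlinarith [mul_pos hw0 hk0, mul_pos hw0 hx0]
  have hDLpos : 0 < (1 - x) * ((1 - x) * w + (1 + x) - (w * k + g)) := mul_pos h1x hDLin
  have hU0 : c < (B : ℝ) → usage x c j 0 B = (w * k + g) / (1 - w * k - g) := by
    intro hcBlt
    rw [usage0_eq_heavy x c j B hx0 hx1 hBj (by linarith) hcBlt (by rw [hcw]; nlinarith [mul_le_mul_of_nonneg_left hxg hB0.le])]
    have hD0 : 0 < 1 - w * k - g := by
      have : (B : ℝ) * (w * k + g) < B := by rw [← hcw]; exact hcBlt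
      nlinarith
    have hden1 : (B : ℝ) - c ≠ 0 := by linarith
    rw [div_eq_div_iff hden1 hD0.ne', hcw]
    ring
  have hUH : x * ((B : ℝ) - A) ≤ c - 2 * A → usage x c j A B = (w * k + g - 2 * w) / (w + 1 - w * k - g) := by
    intro hH
    rw [usage_eq_heavy' x c j A B hx0 hx1 hBj hlow hcAB hH]
    have e1 : c - 2 * (A : ℝ) = B * (w * k + g - 2 * w) := by rw [hcw, hAw]; ring
    have e2 : (A : ℝ) + B - c = B * (w + 1 - w * k - g) := by rw [hcw, hAw]; ring
    rw [e1, e2, mul_div_mul_left _ _ hB0.ne']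
  have hUL : c - 2 * A ≤ x * ((B : ℝ) - A) → usage x c j A B
      = (x ^ 2 * (1 - w) + (1 - x) * (w * k + g - 2 * w)) / ((1 - x) * ((1 - x) * w + (1 + x) - (w * k + g))) := by
    intro hL
    rw [usage_eq_light' x c j A B hx0 hx1 hBj hlow hcAB hL]
    have e1 : x ^ 2 * ((B : ℝ) - A) + (1 - x) * (c - 2 * (A : ℝ)) = B * (x ^ 2 * (1 - w) + (1 - x) * (w * k + g - 2 * w)) := by
      rw [hcw, hAw]; ring
    have e2 : (1 - x) * ((1 - x) * (A : ℝ) + (1 + x) * B - c) = B * ((1 - x) * ((1 - x) * w + (1 + x) - (w * k + g))) := by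
      rw [hcw, hAw]; ring
    rw [e1, e2, mul_div_mul_left _ _ hB0.ne']
  -- the usage of the pair (A, B) as NUM/DEN in the `w`-coordinates, in either regime
  obtain ⟨NUM, DEN, hNUM, hDEN, hU, hcell⟩ : ∃ NUM DEN : ℝ, 0 < NUM ∧ 0 < DEN ∧ usage x c j A B = NUM / DEN ∧
      (x / (1 - x) * ((γ * (1 - g)) - ((1 - γ) * g) * DEN / NUM + ((1 - γ) * (1 - g))) ≤ γ * g) ∧
      (1 ≤ w * k + g → x / (1 - x) * ((1 - γ) * (1 - g)) ≤ γ * g) ∧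
      (w * k + g < 1 → x / (1 - x) * (((1 - γ) * (1 - g)) - (((1 - γ) * g) * DEN - NUM * (γ * (1 - g))) * (1 - w * k - g)
          / (DEN * (w * k + g))) ≤ γ * g) := by
    rcases le_or_gt (x * ((B : ℝ) - A)) (c - 2 * A) with hH | hL
    · have hrho : x * (1 - w) ≤ w * k + g - 2 * w := by
        have e1 : c - 2 * (A : ℝ) = B * (w * k + g - 2 * w) := by rw [hcw, hAw]; ring
        have e2 : x * ((B : ℝ) - A) = B * (x * (1 - w)) := by rw [hAw]; ring
        rw [e1, e2] at hH
        exact le_of_mul_le_mul_left hH hB0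
      refine ⟨_, _, hNHpos, hDHpos, hUH hH, ?_, ?_, ?_⟩
      · have := tfpCell_LC_LH_b x k g w hx0 hx1 hk0 hkx hxg hg1 hw0 hw1 hloww hrho
        rw [hγk]; exact this
      · intro hsig; have := tfpCell_LC_LH_a0 x k g w hx0 hx1 hk0 hkx hxg hg1 hw0 hw1 hloww hrho hsig
        rw [hγk]; exact this
      · intro hsig; have := tfpCell_LC_LH_a2 x k g w hx0 hx1 hk0 hkx hxg hg1 hw0 hw1 hloww hrho hsig
        rw [hγk]; exact this
    · have hrho : w * k + g - 2 * w ≤ x * (1 - w) := by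
        have e1 : c - 2 * (A : ℝ) = B * (w * k + g - 2 * w) := by rw [hcw, hAw]; ring
        have e2 : x * ((B : ℝ) - A) = B * (x * (1 - w)) := by rw [hAw]; ring
        rw [e1, e2] at hL
        exact (le_of_mul_le_mul_left hL.le hB0)
      refine ⟨_, _, hNLpos, hDLpos, hUL hL.le, ?_, ?_, ?_⟩
      · have := tfpCell_LC_LL_b x k g w hx0 hx1 hk0 hkx hxg hg1 hw0 hw1 hloww hrho
        rw [hγk]; exact this
      · intro hsig; have := tfpCell_LC_LL_a0 x k g w hx0 hx1 hk0 hkx hxg hg1 hw0 hw1 hloww hrho hsig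
        rw [hγk]; exact this
      · intro hsig; have := tfpCell_LC_LL_a2 x k g w hx0 hx1 hk0 hkx hxg hg1 hw0 hw1 hloww hrho hsig
        rw [hγk]; exact this
  obtain ⟨hb, ha0, ha2⟩ := hcell
  have hUpos : 0 < usage x c j A B := by rw [hU]; exact div_pos hNUM hDEN
  have hjs : j < A + B := by omega
  -- case split of the corner flow
  rcases le_or_gt ((1 - γ) * g) (γ * (1 - g) * usage x c j A B) with hcase | hcase
  · -- case b: the mid is exhausted by atom A
    refine twoBlob_decAtT_of_twoLowFlow_top x γ g c 0 (((1 - γ) * g) * DEN / NUM) A B j hx0 hx1 hA hAB hBj hjs hlow hcB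
      (div_nonneg (mul_nonneg hmB hDEN.le) hNUM.le) ?_ (fun _ => hcAB) le_rfl hm0 (fun h => absurd h (lt_irrefl 0)) ?_ ?_
    · rw [hU] at hcase
      rw [div_le_iff₀ hNUM]
      have := mul_le_mul_of_nonneg_right hcase hDEN.le
      rw [mul_assoc (γ * (1 - g)), div_mul_cancel₀ _ hDEN.ne'] at this
      linarith
    · rw [hU, mul_zero, add_zero]
      rw [show NUM / DEN * ((1 - γ) * g * DEN / NUM) = (1 - γ) * g by field_simp]
    · simpa [sub_zero] using hb
  · by_cases hcBlt : c < (B : ℝ)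
    · have hU0' := hU0 hcBlt
      have hsig : w * k + g < 1 := by
        have : (B : ℝ) * (w * k + g) < B := by rw [← hcw]; exact hcBlt
        nlinarith
      have hD0pos : 0 < 1 - w * k - g := by linarith
      have hU0pos : 0 < usage x c j 0 B := by rw [hU0']; exact div_pos hN0pos hD0pos
      set R : ℝ := (1 - γ) * g - usage x c j A B * (γ * (1 - g)) with hR
      have hR0 : 0 ≤ R := by rw [hR]; linarith
      by_cases hfit : (1 - γ) * (1 - g) * usage x c j 0 B ≤ R
      · -- case a1: both lows are fully absorbed by the mid; nothing goes to the giant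
        refine twoBlob_decAtT_of_twoLowFlow_top x γ g c ((1 - γ) * (1 - g)) (γ * (1 - g)) A B j hx0 hx1 hA hAB hBj hjs hlow hcB
          hmA le_rfl (fun _ => hcAB) hm0 le_rfl (fun _ => hcBlt) ?_ ?_
        · rw [hR] at hfit; linarith
        · rw [sub_self, sub_self, add_zero, mul_zero]; exact hmAB
      · -- case a2
        push Not at hfit
        refine twoBlob_decAtT_of_twoLowFlow_top x γ g c (R / usage x c j 0 B) (γ * (1 - g)) A B j hx0 hx1 hA hAB hBj hjs hlow hcB
          hmA le_rfl (fun _ => hcAB) (div_nonneg hR0 hU0pos.le) ?_ (fun _ => hcBlt) ?_ ?_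
        · rw [div_le_iff₀ hU0pos]; linarith
        · rw [mul_div_cancel₀ _ hU0pos.ne', hR]; linarith
        · have e : R / usage x c j 0 B = (((1 - γ) * g) * DEN - NUM * (γ * (1 - g))) * (1 - w * k - g) / (DEN * (w * k + g)) := by
            rw [hR, hU, hU0']; field_simp
          rw [sub_self, zero_add, e]
          exact ha2 hsig
    · -- case a0: the mid cannot take atom 0
      push Not at hcBlt
      have hsig : 1 ≤ w * k + g := by
        have : (B : ℝ) ≤ B * (w * k + g) := by rw [← hcw]; exact hcBlt
        nlinarith
      refine twoBlob_decAtT_of_twoLowFlow_top x γ g c 0 (γ * (1 - g)) A B j hx0 hx1 hA hAB hBj hjs hlow hcB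
        hmA le_rfl (fun _ => hcAB) le_rfl hm0 (fun h => absurd h (lt_irrefl 0)) ?_ ?_
      · rw [mul_zero, add_zero]; linarith
      · rw [sub_self, zero_add, sub_zero]; exact ha0 hsig

/-! ### The same piece shifted, in cell coordinates, as a convolution -/

/-- **THE LOW-CROSS HEAVY-LONG PIECE, SHIFTED**: shift `s`, any top `M ≥ s + A + B`, any target `T′ ≤ 2s + c`; `s + B ≤ j < s + A + B`,
`2A < c ≤ 2B`. [this work] -/
theorem twoBlobShift_lowCross_heavyLong_decAtT (x γ g T' : ℝ) (s A B j M : ℕ) (hx0 : 0 < x) (hx1 : x < 1)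
    (hγ0 : x ^ 2 < γ) (hγx : γ < x) (hxg : x ≤ g) (hg1 : g ≤ 1) (hA : 1 ≤ A) (hAB : A < B)
    (hBj : s + B ≤ j) (hj : j + 1 ≤ s + A + B) (hM : s + A + B ≤ M)
    (hlow : 2 * (A : ℝ) < (A : ℝ) * ((γ - x ^ 2) / (1 - x)) + (B : ℝ) * g) (hcB : (A : ℝ) * ((γ - x ^ 2) / (1 - x)) + (B : ℝ) * g ≤ 2 * (B : ℝ))
    (hT' : T' ≤ 2 * (s : ℝ) + ((A : ℝ) * ((γ - x ^ 2) / (1 - x)) + (B : ℝ) * g)) :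
    DECAtT x T' j M (fun h => if s ≤ h then LAW2[A, γ, B, g, h - s] else 0) := by
  classical
  have hdec := twoBlob_lowCross_heavyLong_decAtT x γ g A B (j - s) hx0 hx1 hγ0 hγx hxg hg1 hA hAB (by omega) (by omega) hlow hcB
  have hsh := decAtT_shift_two x _ (j - s) (A + B) s _ hdec
  rw [show j - s + s = j by omega] at hsh
  exact decAtT_antitone_target (by linarith) (decAtT_mono_top hsh (by omega))

/-- **THE LOW-CROSS HEAVY-LONG PIECE in cell coordinates**: a light cell `{lo₁, hi₁; γ}` and a LONGER heavy cell `{lo₂, hi₂; g}`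
(`hi₁ − lo₁ < hi₂ − lo₂`), the four-atom piece at every target `T′ ≤` the sum of the two (N)-credits, at a layer `j′` with
`lo₁ + hi₂ ≤ j′ < hi₁ + hi₂`, when the cross atom `hi₁ + lo₂` is LOW at the credit target. [this work] -/
theorem lowCrossHeavyLongPiece_decAtT (x T' γ g : ℝ) (j' M lo₁ hi₁ lo₂ hi₂ : ℕ) (hx0 : 0 < x) (hx1 : x < 1)
    (hxγ : x ^ 2 < γ) (hγx : γ < x) (hxg : x ≤ g) (hg1 : g ≤ 1) (h₁ : lo₁ < hi₁) (hlong : hi₁ - lo₁ < hi₂ - lo₂)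
    (hM : hi₁ + hi₂ ≤ M) (hj2 : lo₁ + hi₂ ≤ j') (hj : j' + 1 ≤ hi₁ + hi₂)
    (hlow : 2 * ((hi₁ : ℝ) - lo₁) < ((hi₁ : ℝ) - lo₁) * ((γ - x ^ 2) / (1 - x)) + ((hi₂ : ℝ) - lo₂) * g)
    (hcB : ((hi₁ : ℝ) - lo₁) * ((γ - x ^ 2) / (1 - x)) + ((hi₂ : ℝ) - lo₂) * g ≤ 2 * ((hi₂ : ℝ) - lo₂))
    (hT' : T' ≤ 2 * (lo₁ : ℝ) + ((hi₁ : ℝ) - lo₁) * ((γ - x ^ 2) / (1 - x)) + (2 * (lo₂ : ℝ) + ((hi₂ : ℝ) - lo₂) * g)) :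
    DECAtT x T' j' M (fun h => (1 - γ) * (1 - g) * (if h = lo₁ + lo₂ then (1 : ℝ) else 0)
      + γ * (1 - g) * (if h = hi₁ + lo₂ then (1 : ℝ) else 0)
      + (1 - γ) * g * (if h = lo₁ + hi₂ then (1 : ℝ) else 0)
      + γ * g * (if h = hi₁ + hi₂ then (1 : ℝ) else 0)) := by
  classical
  obtain ⟨A, hA⟩ : ∃ A, hi₁ = lo₁ + A := ⟨hi₁ - lo₁, by omega⟩
  obtain ⟨B, hB⟩ : ∃ B, hi₂ = lo₂ + B := ⟨hi₂ - lo₂, by omega⟩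
  have e1 : ((hi₁ : ℝ) - lo₁) = A := by rw [hA]; push_cast; ring
  have e2 : ((hi₂ : ℝ) - lo₂) = B := by rw [hB]; push_cast; ring
  rw [e1, e2] at hT' hlow hcB
  have hmain := twoBlobShift_lowCross_heavyLong_decAtT x γ g T' (lo₁ + lo₂) A B j' M hx0 hx1 hxγ hγx hxg hg1 (by omega) (by omega)
    (by omega) (by omega) (by omega) hlow hcB (by push_cast; linarith)
  have e : (fun h => if lo₁ + lo₂ ≤ h then LAW2[A, γ, B, g, h - (lo₁ + lo₂)] else 0)
      = fun h => (1 - γ) * (1 - g) * (if h = lo₁ + lo₂ then (1 : ℝ) else 0)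
          + γ * (1 - g) * (if h = hi₁ + lo₂ then (1 : ℝ) else 0)
          + (1 - γ) * g * (if h = lo₁ + hi₂ then (1 : ℝ) else 0)
          + γ * g * (if h = hi₁ + hi₂ then (1 : ℝ) else 0) := by
    funext h
    by_cases hs : lo₁ + lo₂ ≤ h
    · rw [if_pos hs]
      have e0 : (h - (lo₁ + lo₂) = 0) ↔ (h = lo₁ + lo₂) := by omega
      have eA : (h - (lo₁ + lo₂) = A) ↔ (h = hi₁ + lo₂) := by omega
      have eB : (h - (lo₁ + lo₂) = B) ↔ (h = lo₁ + hi₂) := by omega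
      have eAB : (h - (lo₁ + lo₂) = A + B) ↔ (h = hi₁ + hi₂) := by omega
      simp only [e0, eA, eB, eAB]
    · rw [if_neg hs, if_neg (by omega), if_neg (by omega), if_neg (by omega), if_neg (by omega)]
      ring
  rw [e] at hmain
  exact hmain

/-- **THE LOW-CROSS HEAVY-LONG PIECE in the `SH`-mixture form of `lconv_TP`.** [this work] -/
theorem shift_lowCrossHeavyLongPairs_decAtT (x T' γ g : ℝ) (j' M lo₁ hi₁ lo₂ hi₂ : ℕ) (hx0 : 0 < x) (hx1 : x < 1)
    (hxγ : x ^ 2 < γ) (hγx : γ < x) (hxg : x ≤ g) (hg1 : g ≤ 1) (h₁ : lo₁ < hi₁) (h₂ : lo₂ < hi₂) (hlong : hi₁ - lo₁ < hi₂ - lo₂)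
    (hM : hi₁ + hi₂ ≤ M) (hj2 : lo₁ + hi₂ ≤ j') (hj : j' + 1 ≤ hi₁ + hi₂)
    (hlow : 2 * ((hi₁ : ℝ) - lo₁) < ((hi₁ : ℝ) - lo₁) * ((γ - x ^ 2) / (1 - x)) + ((hi₂ : ℝ) - lo₂) * g)
    (hcB : ((hi₁ : ℝ) - lo₁) * ((γ - x ^ 2) / (1 - x)) + ((hi₂ : ℝ) - lo₂) * g ≤ 2 * ((hi₂ : ℝ) - lo₂))
    (hT' : T' ≤ 2 * (lo₁ : ℝ) + ((hi₁ : ℝ) - lo₁) * ((γ - x ^ 2) / (1 - x)) + (2 * (lo₂ : ℝ) + ((hi₂ : ℝ) - lo₂) * g)) :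
    DECAtT x T' j' M
      (fun h => (1 - g) * SH[(fun t => TP[lo₁, hi₁, γ, t]), lo₂, h] + g * SH[(fun t => TP[lo₁, hi₁, γ, t]), hi₂, h]) := by
  have e : (fun h => (1 - g) * SH[(fun t => TP[lo₁, hi₁, γ, t]), lo₂, h] + g * SH[(fun t => TP[lo₁, hi₁, γ, t]), hi₂, h])
      = fun h => (1 - γ) * (1 - g) * (if h = lo₁ + lo₂ then (1 : ℝ) else 0)
          + γ * (1 - g) * (if h = hi₁ + lo₂ then (1 : ℝ) else 0)
          + (1 - γ) * g * (if h = lo₁ + hi₂ then (1 : ℝ) else 0)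
          + γ * g * (if h = hi₁ + hi₂ then (1 : ℝ) else 0) :=
    funext fun h => shift_TP_pair_eq γ g lo₁ hi₁ lo₂ hi₂ h h₂.le
  rw [e]
  exact lowCrossHeavyLongPiece_decAtT x T' γ g j' M lo₁ hi₁ lo₂ hi₂ hx0 hx1 hxγ hγx hxg hg1 h₁ hlong hM hj2 hj hlow hcB hT'

/-- **THE LOW-CROSS HEAVY-LONG PIECE as a convolution of two cells** (census-2 g53's `LawDec.lconv`). [this work] -/
theorem lconv_lowCrossHeavyLongPairs_decAtT (x T' γ g : ℝ) (j' M₁ M₂ lo₁ hi₁ lo₂ hi₂ : ℕ) (hx0 : 0 < x) (hx1 : x < 1)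
    (hxγ : x ^ 2 < γ) (hγx : γ < x) (hxg : x ≤ g) (hg1 : g ≤ 1) (h₁ : lo₁ < hi₁) (hM₁ : hi₁ ≤ M₁) (h₂ : lo₂ < hi₂) (hM₂ : hi₂ ≤ M₂)
    (hlong : hi₁ - lo₁ < hi₂ - lo₂) (hj2 : lo₁ + hi₂ ≤ j') (hj : j' + 1 ≤ hi₁ + hi₂)
    (hlow : 2 * ((hi₁ : ℝ) - lo₁) < ((hi₁ : ℝ) - lo₁) * ((γ - x ^ 2) / (1 - x)) + ((hi₂ : ℝ) - lo₂) * g)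
    (hcB : ((hi₁ : ℝ) - lo₁) * ((γ - x ^ 2) / (1 - x)) + ((hi₂ : ℝ) - lo₂) * g ≤ 2 * ((hi₂ : ℝ) - lo₂))
    (hT' : T' ≤ 2 * (lo₁ : ℝ) + ((hi₁ : ℝ) - lo₁) * ((γ - x ^ 2) / (1 - x)) + (2 * (lo₂ : ℝ) + ((hi₂ : ℝ) - lo₂) * g)) :
    DECAtT x T' j' (M₁ + M₂) (lconv M₁ M₂ (fun t => TP[lo₁, hi₁, γ, t]) (fun t => TP[lo₂, hi₂, g, t])) := by
  have e : lconv M₁ M₂ (fun t => TP[lo₁, hi₁, γ, t]) (fun t => TP[lo₂, hi₂, g, t])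
      = fun h => (1 - g) * SH[(fun t => TP[lo₁, hi₁, γ, t]), lo₂, h] + g * SH[(fun t => TP[lo₁, hi₁, γ, t]), hi₂, h] :=
    funext fun h => lconv_TP M₁ M₂ lo₂ hi₂ (fun t => TP[lo₁, hi₁, γ, t]) g
      (fun t ht => TP_eq_zero_of_top_lt lo₁ hi₁ M₁ γ h₁.le hM₁ t ht) (h₂.le.trans hM₂) hM₂ h
  rw [e]
  exact shift_lowCrossHeavyLongPairs_decAtT x T' γ g j' (M₁ + M₂) lo₁ hi₁ lo₂ hi₂ hx0 hx1 hxγ hγx hxg hg1 h₁ h₂ hlong (by omega) hj2 hj hlow hcB hT'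

end LawDec

end Quant

end Summit.CriticalPhenomena.PercolationContinuityZ3.Theorems
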